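import Summits.ResolutionOfSingularities.ResolutionOfSingularities.Theorems.MarkedTransferCampaignW46MohWindowShadeFormalStep
import Summits.ResolutionOfSingularities.ResolutionOfSingularities.Theorems.MarkedTransferCampaignW46IsolatedThread
import Summits.ResolutionOfSingularities.ResolutionOfSingularities.Theorems.WildConesCampaignW46RationalPoint
import HarnessLib

/-!
# [OURS · L1 W4.6 rung (iii-2), FORMAL ENTRANCE DOOR, brick 3 = ASSEMBLY] An infinite §2.1-permissible sequence inside o1's regime
# `regimeMohWindowSurfaceInsep` whose hit thread is rooted at a FORMALLY ANCHORED point does not exist; the stage-0 form over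
# algebraically closed fields

Cell `res-hironaka`, LADDER-RESOLUTION rung L (D-0089), slot W4.6 rung (iii); seat res-L1-s46-pv-6 (gen 5). Host route MarkedTransfer,
`--supports stmt-ResolutionOfSingularities-16155 --as helper`; kind proof (no definition).

WHAT (res-D-pv-008 AS s46-pv-14's clause (R1), H2-CENSUS item 10; the FORMAL version of gen 4's `…MohWindowShadeAnchorWalk.lean`).
* `formalAnchor_succ` — one step along a hit thread: a formal anchor (Cohen coordinates `E : 𝒪̂ ≅ K⟦z, u₀, u₁⟧`, `J = (f₀)`,
  `E(f₀) = w · (z^p + F_s(u₀, u₁))`) with model state `s` at `y_k` yields a formal anchor at `y_{k+1}` with state `PointBlowup.step p c b s` at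
  an EQUIMULTIPLE point in the Hauser–Wagner frame if stage `k` blows up `y_k` (brick 2c `exists_formalAnchor_step`), and with the same state
  otherwise (`exists_formalAnchor_offCentre`). Hypothesis: the thread points are RESIDUALLY RATIONAL over their images (`hrat`, a parameter).
* `false_of_hitThread_formalAnchor` — THE THEOREM: along a hit thread rooted at a formally anchored point with CLEANED model polynomial the
  anchors propagate (recursion), the states at the hit stages (`Nat.nth`) form an infinite in-window (brick 1 `window_of_formalAnchor`:
  `p ≤ ord₀ F < 2p`) equimultiple Hauser–Wagner walk with cleaned start, so by this seat's gen-3 theorem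
  `MohWindowShadeFormalBranch.exists_coordinate_or_digit_curve_of_walk` some stage carries a coordinate or digit formal `p`-fold curve, which
  brick 1's exits (res-D-pv-050's door) forbid in the regime.
* `false_of_permissibleRun_insep_formalStart` — STAGE-0 FORM over an ALGEBRAICALLY CLOSED field (closed points are rational over their images,
  res-L1-s46-pv-2's `exists_sub_stalkMap_mem_maximalIdeal_of_isClosed`): no infinite §2.1-permissible sequence inside `regimeMohWindowSurfaceInsep`
  whose stage-0 singular points are formally anchored with cleaned polynomials `F ∈ K[y₀, y₁]` — in SOME Cohen coordinates `J_ξ 𝒪̂_ξ =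
  (z^p + F(u₀, u₁))`; no regular system of parameters of the Zariski local ring and no constants map are asked for (gen 4 asked for both).
`K : Type` (universe of pv-2's dictionary).

HONEST FRAMING. Nothing here is a statement of H. Hironaka's manuscript [Hironaka2017] (2017-03-23; Th. 16.6 p.84, Th. 16.13 p.87 — scope only,
under adjudication) and nothing asserts that any statement of it holds; `regimeMohWindowSurfaceInsep` is res-L1-type-o1's OURS regime. AI-written;
AI review is weaker than expert review. No `sorry`; axioms standard. References: H. Hauser, Bull. AMS 47 (2010) §F; Stacks Project Tag 0CY7
(closed points over algebraically closed fields), Tag 0804. [Hauser2010] [StacksProject] [folklore]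
-/

noncomputable section

set_option linter.dupNamespace false -- mandated namespace of this single-conjunct summit

open IsLocalRing MvPolynomial

namespace Summit.ResolutionOfSingularities.ResolutionOfSingularities.Theorems

namespace CampaignW46

namespace MohWindowShadeFormalWalk

open CategoryTheory AlgebraicGeometry TopologicalSpace
open Literature.AlgebraicGeometry.Resolution
open Literature.AlgebraicGeometry.Resolution.PointBlowup
open Literature.AlgebraicGeometry.Resolution.Hauser2010
open Literature.AlgebraicGeometry.Hironaka2017.S02Preliminaries
open Literature.AlgebraicGeometry.Hironaka2017.Datum
open Scheme.IdealSheafData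
open MohWindowShadeFormalAnchor (window_of_formalAnchor window_strict_of_formalAnchor not_regime_of_formalAnchor_coordinate
  not_regime_of_formalAnchor_digit)
open MohWindowShadeFormalStep (exists_formalAnchor_step exists_formalAnchor_offCentre)

variable {p : ℕ} [hp : Fact p.Prime] {K : Type} [Field K] [CharP K p]

/-! ## §1 One step along a hit thread -/

section Thread

variable [PerfectRing K p] [DecidableEq K]

/-- **One step along a hit thread, formal anchors.** [OURS · L1 W4.6 rung (iii-2)] NOT a statement of the manuscript. See the module docstring.
[cite: StacksProject, Tag 0804] -/
theorem formalAnchor_succ (r : PermissibleRun p K) (hr : ∀ k, regimeMohWindowSurfaceInsep (p := p) (K := K) (r.A k) (r.E k))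
    (t : r.HitThread) (k : ℕ)
    (hrat : ∀ y : (r.A (k + 1)).Z.presheaf.stalk (t.y (k + 1)), ∃ x : (r.A k).Z.presheaf.stalk ((r.π k).base (t.y (k + 1))),
      y - ((r.π k).stalkMap (t.y (k + 1))).hom x ∈ maximalIdeal _)
    (s : State (Fin 2) K)
    (hA : ∃ (e : AdicCompletion (maximalIdeal ((r.A k).Z.presheaf.stalk (t.y k))) ((r.A k).Z.presheaf.stalk (t.y k)) ≃+*
        MvPowerSeries (Option (Fin 2)) K) (f₀ : (r.A k).Z.presheaf.stalk (t.y k)) (w : MvPowerSeries (Option (Fin 2)) K),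
      stalkIdeal (r.E k).J (t.y k) = Ideal.span {f₀} ∧ IsUnit w ∧
        e (algebraMap _ _ f₀) = w * (MvPowerSeries.X none ^ p + eval₂ MvPowerSeries.C
          (fun l : Fin 2 => if l = (0 : Fin 2) then MvPowerSeries.X (some (0 : Fin 2)) else MvPowerSeries.X (some 1)) s.F)) :
    ∃ (s' : State (Fin 2) K) (c : Fin 2) (b : Fin 2 → K),
      ((r.D k : Set (r.A k).Z) = {t.y k} → s' = step p c b s ∧ b c = 0 ∧ (c = 1 → ∀ l, b l = 0) ∧ IsEquimultiplePoint p c b s) ∧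
      ((r.D k : Set (r.A k).Z) ≠ {t.y k} → s' = s) ∧
      ∃ (e : AdicCompletion (maximalIdeal ((r.A (k + 1)).Z.presheaf.stalk (t.y (k + 1)))) ((r.A (k + 1)).Z.presheaf.stalk (t.y (k + 1))) ≃+*
          MvPowerSeries (Option (Fin 2)) K) (f₀ : (r.A (k + 1)).Z.presheaf.stalk (t.y (k + 1))) (w : MvPowerSeries (Option (Fin 2)) K),
        stalkIdeal (r.E (k + 1)).J (t.y (k + 1)) = Ideal.span {f₀} ∧ IsUnit w ∧
          e (algebraMap _ _ f₀) = w * (MvPowerSeries.X none ^ p + eval₂ MvPowerSeries.C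
            (fun l : Fin 2 => if l = (0 : Fin 2) then MvPowerSeries.X (some (0 : Fin 2)) else MvPowerSeries.X (some 1)) s'.F) := by
  classical
  -- data at stage `k`, moved to the point `π (y (k+1))`
  have hc := t.compat k
  have hmem : (r.π k).base (t.y (k + 1)) ∈ (r.E k).sing := by rw [hc]; exact t.mem k
  obtain ⟨hR, h3, hcl, -, hb⟩ := MohWindowShadeAnchorWalk.regime_point (hr k) hmem
  haveI := hR
  have hA' : ∃ (e : AdicCompletion (maximalIdeal ((r.A k).Z.presheaf.stalk ((r.π k).base (t.y (k + 1)))))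
        ((r.A k).Z.presheaf.stalk ((r.π k).base (t.y (k + 1)))) ≃+* MvPowerSeries (Option (Fin 2)) K)
      (f₀ : (r.A k).Z.presheaf.stalk ((r.π k).base (t.y (k + 1)))) (w : MvPowerSeries (Option (Fin 2)) K),
      stalkIdeal (r.E k).J ((r.π k).base (t.y (k + 1))) = Ideal.span {f₀} ∧ IsUnit w ∧
        e (algebraMap _ _ f₀) = w * (MvPowerSeries.X none ^ p + eval₂ MvPowerSeries.C
          (fun l : Fin 2 => if l = (0 : Fin 2) then MvPowerSeries.X (some (0 : Fin 2)) else MvPowerSeries.X (some 1)) s.F) := by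
    rw [hc]; exact hA
  obtain ⟨e, f₀, w, hJ, hw, hE⟩ := hA'
  have hwin := window_of_formalAnchor (hr k) hmem e hJ hw s.F hE
  have hdeg : ∀ d ∈ s.F.support, p ≤ d.degree := fun d hd =>
    (Literature.Barriers.ResolutionOfSingularities.HauserPerlega.natCast_le_ordZero_iff s.F p).mp hwin.1 d hd
  have hsing' : t.y (k + 1) ∈ ((r.E k).transform (r.π k) (r.D k)).sing := by
    have := t.mem (k + 1); rwa [r.E_succ k] at this
  by_cases hhit : (r.D k : Set (r.A k).Z) = {t.y k}
  · -- the thread point is blown up: the model takes a step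
    have hD : (r.D k : Set (r.A k).Z) = {(r.π k).base (t.y (k + 1))} := by rw [hc]; exact hhit
    obtain ⟨c, b, e', f', w', hbc, hHW, heq, hJ', hw', hE'⟩ :=
      exists_formalAnchor_step (r.π k) (r.D k) (r.blowup k) hb hD hmem hsing' h3 hrat e hJ hw s hdeg hE
    refine ⟨step p c b s, c, b, fun _ => ⟨rfl, hbc, hHW, heq⟩, fun h => absurd hhit h, e', f', w', ?_, hw', hE'⟩
    rw [r.E_succ k]; exact hJ'
  · -- the thread point is not blown up: transport
    obtain ⟨ξ₀, -, -, hDξ₀⟩ := IsPermissibleCentre.exists_eq_singleton_of_isolatedSing (r.permissible k)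
      ((regimeMohWindowSurfaceInsep_iff _ _).mp (hr k)).1.1
    have hoff : (r.π k).base (t.y (k + 1)) ∉ (r.D k : Set (r.A k).Z) := by
      rw [hc, hDξ₀, Set.mem_singleton_iff]
      rintro rfl
      exact hhit hDξ₀
    obtain ⟨e', f', hJ', hE'⟩ := exists_formalAnchor_offCentre (E := r.E k) (r.π k) (r.blowup k) hoff e hJ _ hE
    refine ⟨s, 0, 0, fun h => absurd h hhit, fun _ => rfl, e', f', w, ?_, hw, hE'⟩
    rw [r.E_succ k]; exact hJ'

/-! ## §2 The theorem -/

/-- **THE FORMAL ENTRANCE DOOR CLOSES ON THE EXIT DOOR.** [OURS · L1 W4.6 rung (iii-2)] NOT a statement of the manuscript. An infinite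
§2.1-permissible sequence inside o1's regime `regimeMohWindowSurfaceInsep` with a hit thread whose points are residually rational over their
images and whose initial point carries a FORMAL anchor with CLEANED model polynomial `F₀` does not exist: the thread carries the shade-model walk
(`formalAnchor_succ`), the walk is infinite, in the window and equimultiple, so by this seat's gen-3 theorem it meets a formal `p`-fold curve,
which res-D-pv-050's exit door forbids in the regime. [cite: Hauser2010, §F (setting f = x^p + y^r g)] [cite: StacksProject, Tag 0804] -/
theorem false_of_hitThread_formalAnchor (r : PermissibleRun p K)
    (hr : ∀ k, regimeMohWindowSurfaceInsep (p := p) (K := K) (r.A k) (r.E k)) (t : r.HitThread)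
    (hrat : ∀ k (y : (r.A (k + 1)).Z.presheaf.stalk (t.y (k + 1))), ∃ x : (r.A k).Z.presheaf.stalk ((r.π k).base (t.y (k + 1))),
      y - ((r.π k).stalkMap (t.y (k + 1))).hom x ∈ maximalIdeal _)
    (F₀ : MvPolynomial (Fin 2) K) (hclean : deletePthPowers p F₀ = F₀)
    (hA0 : ∃ (e : AdicCompletion (maximalIdeal ((r.A 0).Z.presheaf.stalk (t.y 0))) ((r.A 0).Z.presheaf.stalk (t.y 0)) ≃+*
        MvPowerSeries (Option (Fin 2)) K) (f₀ : (r.A 0).Z.presheaf.stalk (t.y 0)) (w : MvPowerSeries (Option (Fin 2)) K),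
      stalkIdeal (r.E 0).J (t.y 0) = Ideal.span {f₀} ∧ IsUnit w ∧
        e (algebraMap _ _ f₀) = w * (MvPowerSeries.X none ^ p + eval₂ MvPowerSeries.C
          (fun l : Fin 2 => if l = (0 : Fin 2) then MvPowerSeries.X (some (0 : Fin 2)) else MvPowerSeries.X (some 1)) F₀)) :
    False := by
  classical
  -- the anchor predicate at stage `k` for a model state
  let Anch : ∀ k, State (Fin 2) K → Prop := fun k s =>
    ∃ (e : AdicCompletion (maximalIdeal ((r.A k).Z.presheaf.stalk (t.y k))) ((r.A k).Z.presheaf.stalk (t.y k)) ≃+*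
        MvPowerSeries (Option (Fin 2)) K) (f₀ : (r.A k).Z.presheaf.stalk (t.y k)) (w : MvPowerSeries (Option (Fin 2)) K),
      stalkIdeal (r.E k).J (t.y k) = Ideal.span {f₀} ∧ IsUnit w ∧
        e (algebraMap _ _ f₀) = w * (MvPowerSeries.X none ^ p + eval₂ MvPowerSeries.C
          (fun l : Fin 2 => if l = (0 : Fin 2) then MvPowerSeries.X (some (0 : Fin 2)) else MvPowerSeries.X (some 1)) s.F)
  -- the anchors along the thread, by recursion
  have G : ∀ (k : ℕ) (P : {s : State (Fin 2) K // Anch k s}),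
      ∃ (Q : {s : State (Fin 2) K // Anch (k + 1) s}) (c : Fin 2) (b : Fin 2 → K),
        ((r.D k : Set (r.A k).Z) = {t.y k} → Q.1 = step p c b P.1 ∧ b c = 0 ∧ (c = 1 → ∀ l, b l = 0) ∧
          IsEquimultiplePoint p c b P.1) ∧
        ((r.D k : Set (r.A k).Z) ≠ {t.y k} → Q.1 = P.1) := by
    intro k P
    obtain ⟨s', c, b, h1, h2, hA'⟩ := formalAnchor_succ r hr t k (hrat k) P.1 P.2
    exact ⟨⟨s', hA'⟩, c, b, h1, h2⟩
  choose next nc nb hnext using G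
  let seq : ∀ k, {s : State (Fin 2) K // Anch k s} :=
    fun k => Nat.rec (motive := fun k => {s : State (Fin 2) K // Anch k s}) ⟨⟨F₀, 0⟩, hA0⟩ (fun k P => next k P) k
  have hseq : ∀ k, seq (k + 1) = next k (seq k) := fun k => rfl
  have hseq0 : (seq 0).1 = ⟨F₀, 0⟩ := rfl
  -- the hit stages
  set P : ℕ → Prop := fun k => (r.D k : Set (r.A k).Z) = {t.y k} with hP
  have hinf : (setOf P).Infinite :=
    Nat.frequently_atTop_iff_infinite.mp (Filter.frequently_atTop.mpr fun a => t.hit a)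
  have hPnth : ∀ n, P (Nat.nth P n) := Nat.nth_mem_of_infinite hinf
  have hgap : ∀ n m, Nat.nth P n < m → m < Nat.nth P (n + 1) → ¬ P m := by
    intro n m h1 h2 hm
    obtain ⟨i, -, hi⟩ := Nat.exists_lt_card_nth_eq hm
    rw [← hi] at h1 h2
    have := (Nat.nth_lt_nth hinf).mp h1
    have := (Nat.nth_lt_nth hinf).mp h2
    omega
  have hgap0 : ∀ m, m < Nat.nth P 0 → ¬ P m := by
    intro m h hm
    obtain ⟨i, -, hi⟩ := Nat.exists_lt_card_nth_eq hm
    rw [← hi] at h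
    have := (Nat.nth_lt_nth hinf).mp h
    omega
  -- the state is constant off the hit stages
  have hstay : ∀ m, ¬ P m → (seq (m + 1)).1 = (seq m).1 := fun m hm => by
    rw [hseq]; exact (hnext m (seq m)).2 hm
  have hconst : ∀ n d, Nat.nth P n + 1 + d ≤ Nat.nth P (n + 1) →
      (seq (Nat.nth P n + 1 + d)).1 = (seq (Nat.nth P n + 1)).1 := by
    intro n d
    induction d with
    | zero => intro _; rfl
    | succ d ih =>
      intro hle
      have h1 : (seq (Nat.nth P n + 1 + d + 1)).1 = (seq (Nat.nth P n + 1 + d)).1 :=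
        hstay _ (hgap n _ (by omega) (by omega))
      rw [← ih (by omega), ← h1]
      rfl
  have hconst0 : ∀ d, d ≤ Nat.nth P 0 → (seq d).1 = (seq 0).1 := by
    intro d
    induction d with
    | zero => intro _; rfl
    | succ d ih =>
      intro hle
      rw [hstay d (hgap0 d (by omega))]
      exact ih (by omega)
  -- the model walk
  set sM : ℕ → State (Fin 2) K := fun n => (seq (Nat.nth P n)).1 with hsM
  set cM : ℕ → Fin 2 := fun n => nc (Nat.nth P n) (seq (Nat.nth P n)) with hcM
  set bM : ℕ → Fin 2 → K := fun n => nb (Nat.nth P n) (seq (Nat.nth P n)) with hbM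
  have hhitrel : ∀ n, (seq (Nat.nth P n + 1)).1 = step p (cM n) (bM n) (sM n) ∧ bM n (cM n) = 0 ∧
      (cM n = 1 → ∀ l, bM n l = 0) ∧ IsEquimultiplePoint p (cM n) (bM n) (sM n) := by
    intro n
    have h := (hnext (Nat.nth P n) (seq (Nat.nth P n))).1 (hPnth n)
    rw [← hseq] at h
    exact h
  have hstepM : ∀ n, sM (n + 1) = step p (cM n) (bM n) (sM n) := by
    intro n
    have hlt : Nat.nth P n < Nat.nth P (n + 1) := (Nat.nth_lt_nth hinf).mpr (Nat.lt_succ_self n)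
    obtain ⟨d, hd⟩ : ∃ d, Nat.nth P (n + 1) = Nat.nth P n + 1 + d := ⟨Nat.nth P (n + 1) - (Nat.nth P n + 1), by omega⟩
    rw [← (hhitrel n).1]
    show (seq (Nat.nth P (n + 1))).1 = _
    rw [hd]
    exact hconst n d (by omega)
  have hwinM : ∀ n, (p : ℕ∞) ≤ ordZero (sM n).F ∧ ordZero (sM n).F < (2 * p : ℕ) := by
    intro n
    obtain ⟨e, f₀, w, hJ, hw, hE⟩ := (seq (Nat.nth P n)).2
    exact window_of_formalAnchor (hr _) (t.mem _) e hJ hw _ hE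
  have hsM0 : sM 0 = ⟨F₀, 0⟩ := by
    show (seq (Nat.nth P 0)).1 = _
    rw [hconst0 _ le_rfl, hseq0]
  -- the gen-3 termination theorem
  obtain ⟨n, hcurve⟩ := MohWindowShadeFormalBranch.exists_coordinate_or_digit_curve_of_walk p (σ := Fin 2) (j := (0 : Fin 2))
    (i := 1) (by decide) (fun l => by fin_cases l <;> simp) sM cM bM (fun n => (hhitrel n).2.1) (fun n => (hhitrel n).2.2.1)
    hstepM (by rw [hsM0]; exact hclean) (by rw [hsM0]; intro d _; exact zero_le) (fun n => (hhitrel n).2.2.2) hwinM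
  -- the exit at the stage `Nat.nth P n`
  set k := Nat.nth P n with hk
  obtain ⟨e, f₀, w, hJ, hw, hE⟩ := (seq k).2
  obtain ⟨-, -, -, -, hb⟩ := MohWindowShadeAnchorWalk.regime_point (hr k) (t.mem k)
  rcases hcurve with ⟨l, W, hF⟩ | ⟨W, hF⟩
  · exact not_regime_of_formalAnchor_coordinate (r.A k) (r.E k) (t.y k) hb e hJ hw l W hF hE (hr k)
  · exact not_regime_of_formalAnchor_digit (r.A k) (r.E k) (t.y k) hb e hJ hw _ W hF hE (hr k)

end Thread

/-! ## §3 Stage-0 form over algebraically closed fields -/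

/-- **STAGE-0 FORM, FORMAL ANCHORS.** [OURS · L1 W4.6 rung (iii-2)] NOT a statement of the manuscript. Over an algebraically closed field there
is NO infinite §2.1-permissible sequence inside o1's regime of record `regimeMohWindowSurfaceInsep` whose INITIAL singular points are formally
anchored with cleaned model polynomials — `J_ξ 𝒪̂_ξ = (z^p + F(u₀, u₁))` in SOME Cohen coordinates, `F ∈ K[y₀, y₁]` cleaned (then `p < ord₀ F < 2p`
is automatic in the regime, brick 1 `window_strict_of_formalAnchor`): such a sequence has a hit thread (res-L1-s46-pv-1), whose closed points are
residually rational over their images (res-L1-s46-pv-2, Zariski's lemma), rooted at an anchored point. [cite: StacksProject, Tag 0CY7] -/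
theorem false_of_permissibleRun_insep_formalStart [IsAlgClosed K] (r : PermissibleRun p K)
    (hr : ∀ k, regimeMohWindowSurfaceInsep (p := p) (K := K) (r.A k) (r.E k))
    (h0 : ∀ ξ ∈ (r.E 0).sing, ∃ (e : AdicCompletion (maximalIdeal ((r.A 0).Z.presheaf.stalk ξ)) ((r.A 0).Z.presheaf.stalk ξ) ≃+*
        MvPowerSeries (Option (Fin 2)) K) (f₀ : (r.A 0).Z.presheaf.stalk ξ) (w : MvPowerSeries (Option (Fin 2)) K) (F : MvPolynomial (Fin 2) K),
      deletePthPowers p F = F ∧ stalkIdeal (r.E 0).J ξ = Ideal.span {f₀} ∧ IsUnit w ∧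
        e (algebraMap _ _ f₀) = w * (MvPowerSeries.X none ^ p + eval₂ MvPowerSeries.C
          (fun l : Fin 2 => if l = (0 : Fin 2) then MvPowerSeries.X (some (0 : Fin 2)) else MvPowerSeries.X (some 1)) F)) : False := by
  classical
  obtain ⟨t⟩ := r.nonempty_hitThread fun k => ((regimeMohWindowSurfaceInsep_iff _ _).mp (hr k)).1.1
  obtain ⟨e, f₀, w, F, hclean, hJ, hw, hE⟩ := h0 (t.y 0) (t.mem 0)
  refine false_of_hitThread_formalAnchor r hr t (fun k y => ?_) F hclean ⟨e, f₀, w, hJ, hw, hE⟩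
  -- closed points over an algebraically closed field are rational over their images
  haveI : LocallyOfFiniteType (r.π k ≫ (r.A k).hom) := by
    rw [← r.hom_eq k]
    haveI := (r.A (k + 1)).smooth
    infer_instance
  obtain ⟨-, -, hcl, -, -⟩ := MohWindowShadeAnchorWalk.regime_point (hr (k + 1)) (t.mem (k + 1))
  exact CampaignW46.ChartPoint.exists_sub_stalkMap_mem_maximalIdeal_of_isClosed (r.π k) (r.A k).hom (t.y (k + 1)) hcl y

end MohWindowShadeFormalWalk

end CampaignW46

end Summit.ResolutionOfSingularities.ResolutionOfSingularities.Theorems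

end
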